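import Literature.Geometry.Lorentzian.VolumeChartFormula
import HarnessLib

/-!
# Integration against the Riemannian measure in a chart:
# `∫_N u dμ_h = ∫_{φ(U)} u(φ⁻¹ y) √(det h_{ij}(y)) dy`

Companion of `Volume.lean` / `VolumeChartFormula.lean`. There the Riemannian measure `μ_h` of a
manifold `N` modelled on `ℝ^m` with a `C^n` Riemannian metric `h` (the Euclidean-normalised
`m`-dimensional Hausdorff measure of the length metric) is shown to satisfy the chart formula on
SETS: `μ_h(S) = ∫_{φ S} √(det h_{ij}) dy` for measurable `S` in the domain `U` of the extended chart
`φ = extChartAt I x` (`riemannianMeasure_eq_integral_sqrt_det_holds`). This file upgrades it to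
the chart formula for INTEGRALS OF FUNCTIONS, the form in which the Riemannian measure is used in
every computation "in local coordinates" (Chavel 2006, §III.3, (III.3.6): `dV = √g dx¹⋯dxⁿ`,
`∫_M f dV = ∫ (f √g) ∘ x⁻¹ dx` for `f` supported in a chart; Lee 2018, Prop. 2.41 ff.; Federer
1969, §3.2.46 with the area formula §3.2.3/§3.2.5):

* `map_extChartAt_restrict_riemannianMeasure` — **the Riemannian measure in a chart as a
  measure**: the push-forward under `φ` of `μ_h` restricted to `U = φ.source` is Lebesgue measure
  on `φ.target` with density `ρ = √(det h_{ij})`,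
  `φ_* (μ_h|_U) = ρ · vol|_{φ.target}`;
* `setLIntegral_extChartAt_comp`, `setIntegral_extChartAt_comp` — for `g` on the model space,
  `∫_U g(φ p) dμ_h(p) = ∫_{φ.target} g(y) ρ(y) dy` (Lebesgue and Bochner integrals), with the
  integrability criterion `integrableOn_extChartAt_comp_iff`;
* `lintegral_eq_lintegral_chart`, `integral_eq_integral_chart`, `integrable_iff_integrableOn_chart`
  — for `u : N → [0,∞]` resp. `N → ℝ` measurable and supported in `U`,
  `∫_N u dμ_h = ∫_{φ.target} u(φ⁻¹ y) ρ(y) dy`, and `u` is `μ_h`-integrable iff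
  `y ↦ u(φ⁻¹ y) ρ(y)` is Lebesgue-integrable on `φ.target`;
* the density: `ρ` is continuous and positive on `φ.target`
  (`continuousOn_sqrt_det_chartGramMatrix`, `sqrt_det_chartGramMatrix_pos`).

Everything is proved; there are no new definitions (the density is the explicit expression
`ENNReal.ofReal √(det (chartGramMatrix h x y))` resp. `√(det (chartGramMatrix h x y))`).
Setting: any model with corners `I` on `EuclideanSpace ℝ (Fin m)`, `C¹` manifold structure,
`[T3Space N] [MeasurableSpace N] [BorelSpace N]` as in `Volume.lean`; no compactness or second
countability. With a partition of unity subordinate to chart domains this gives the global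
coordinate expression of `∫_N u dμ_h` on compact manifolds (not done here).

## Proof

The measure identity is checked on measurable `B ⊆ ℝ^m`: `(φ_* μ_h|_U)(B) = μ_h(U ∩ φ⁻¹ B)`,
and `φ(U ∩ φ⁻¹ B) = φ.target ∩ B`, so the set formula gives `∫_{φ.target ∩ B} ρ dy`. The integral
formulas are then Mathlib's change of variables for push-forward measures (`lintegral_map'`,
`integral_map`, `integrable_map_measure`) and for measures with density
(`lintegral_withDensity_eq_lintegral_mul₀`, `integral_withDensity_eq_integral_toReal_smul₀`,
`integrable_withDensity_iff_integrable_smul₀'`); `φ` is a.e.-measurable on `U` and `φ⁻¹` on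
`φ.target` by continuity.

## References

* I. Chavel, *Riemannian Geometry: A Modern Introduction*, 2nd ed., CUP 2006, §III.3
  (Riemannian measure, (III.3.5)–(III.3.6)).
* J. M. Lee, *Introduction to Riemannian Manifolds*, 2nd ed., Springer 2018, Prop. 2.41 ff.
  (`dV_g = √(det g_{ij}) dx`), and *Introduction to Smooth Manifolds*, Prop. 16.4 ff.
* H. Federer, *Geometric Measure Theory*, Springer 1969, §3.2.3, §3.2.5, §3.2.46.
-/

open Manifold Bundle MeasureTheory Set Filter Function
open scoped ContDiff Topology ENNReal

noncomputable section

namespace Literature.Geometry.Lorentzian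

variable {H : Type*} [TopologicalSpace H] {n : ℕ∞ω} {m : ℕ}
  {I : ModelWithCorners ℝ (EuclideanSpace ℝ (Fin m)) H}
  {N : Type*} [TopologicalSpace N] [ChartedSpace H N] [IsManifold I 1 N]

/-! ### The density `√(det h_{ij})` on the chart target -/

section Density

variable (h : ContMDiffRiemannianMetric I n (EuclideanSpace ℝ (Fin m)) (TangentSpace I : N → Type _))
  (x : N)

set_option backward.isDefEq.respectTransparency false in
/-- On the chart target, the density `√(det h_{ij}(y))` of `Volume.lean` is the chart density
`√(det ⟪e.symmL p eᵢ, e.symmL p eⱼ⟫_p)` of `VolumeChartFormula.lean` at `p = φ⁻¹ y` (standard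
basis `eᵢ`). [folklore] -/
theorem sqrt_det_chartGramMatrix_eq {y : EuclideanSpace ℝ (Fin m)} (hy : y ∈ (extChartAt I x).target) :
    letI : RiemannianBundle (fun x : N ↦ TangentSpace I x) :=
      ⟨h.toContinuousRiemannianMetric.toRiemannianMetric⟩
    Real.sqrt (chartGramMatrix h x y).det =
      Real.sqrt (Matrix.of fun i j ↦
        inner ℝ ((trivializationAt (EuclideanSpace ℝ (Fin m)) (TangentSpace I) x).symmL ℝ
            ((extChartAt I x).symm y) (EuclideanSpace.basisFun (Fin m) ℝ i))
          ((trivializationAt (EuclideanSpace ℝ (Fin m)) (TangentSpace I) x).symmL ℝ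
            ((extChartAt I x).symm y) (EuclideanSpace.basisFun (Fin m) ℝ j))).det := by
  letI : RiemannianBundle (fun x : N ↦ TangentSpace I x) :=
    ⟨h.toContinuousRiemannianMetric.toRiemannianMetric⟩
  congr 2
  ext i j
  rw [Matrix.of_apply, chartGramMatrix_eq_inner_symmL h x hy, EuclideanSpace.basisFun_apply,
    EuclideanSpace.basisFun_apply]

set_option backward.isDefEq.respectTransparency false in
/-- **The Riemannian density is continuous on the chart target**: `y ↦ √(det h_{ij}(y))` is
continuous on `(extChartAt I x).target` (the metric coefficients are continuous, and so is the
inverse chart). Chavel 2006, §III.3. [folklore] -/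
theorem continuousOn_sqrt_det_chartGramMatrix :
    ContinuousOn (fun y ↦ Real.sqrt (chartGramMatrix h x y).det) (extChartAt I x).target := by
  letI : RiemannianBundle (fun x : N ↦ TangentSpace I x) :=
    ⟨h.toContinuousRiemannianMetric.toRiemannianMetric⟩
  have hc := (continuousOn_sqrt_det_gram_symmL (I := I) (EuclideanSpace.basisFun (Fin m) ℝ) x).comp
    (continuousOn_extChartAt_symm x) (fun y hy ↦ by
      rw [← extChartAt_source I]; exact (extChartAt I x).map_target hy)
  refine hc.congr (fun y hy ↦ ?_)
  simp only [Function.comp_apply]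
  exact sqrt_det_chartGramMatrix_eq h x hy

set_option backward.isDefEq.respectTransparency false in
/-- **The Riemannian density is positive on the chart target**: `0 < √(det h_{ij}(y))` for
`y ∈ (extChartAt I x).target` (the Gram matrix of a basis is positive definite). Chavel 2006,
§III.3. [folklore] -/
theorem sqrt_det_chartGramMatrix_pos {y : EuclideanSpace ℝ (Fin m)}
    (hy : y ∈ (extChartAt I x).target) : 0 < Real.sqrt (chartGramMatrix h x y).det := by
  letI : RiemannianBundle (fun x : N ↦ TangentSpace I x) :=
    ⟨h.toContinuousRiemannianMetric.toRiemannianMetric⟩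
  rw [sqrt_det_chartGramMatrix_eq h x hy]
  refine sqrt_det_gram_symmL_pos (EuclideanSpace.basisFun (Fin m) ℝ) x _ ?_
  rw [← extChartAt_source I]
  exact (extChartAt I x).map_target hy

/-- The density `ENNReal.ofReal √(det h_{ij})` is a.e.-measurable for Lebesgue measure restricted
to the (measurable) chart target, being continuous there. [folklore] -/
theorem aemeasurable_ofReal_sqrt_det_chartGramMatrix :
    AEMeasurable (fun y ↦ ENNReal.ofReal (Real.sqrt (chartGramMatrix h x y).det))
      (volume.restrict (extChartAt I x).target) :=
  ENNReal.measurable_ofReal.comp_aemeasurable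
    ((continuousOn_sqrt_det_chartGramMatrix h x).aemeasurable (measurableSet_extChartAt_target x))

/-- The real density `√(det h_{ij})` is a.e.-strongly measurable for Lebesgue measure restricted to
the chart target. [folklore] -/
theorem aestronglyMeasurable_sqrt_det_chartGramMatrix :
    AEStronglyMeasurable (fun y ↦ Real.sqrt (chartGramMatrix h x y).det)
      (volume.restrict (extChartAt I x).target) :=
  (continuousOn_sqrt_det_chartGramMatrix h x).aestronglyMeasurable
    (measurableSet_extChartAt_target x)

end Density

/-! ### Measurability of the chart on its domain -/

section Chart

variable [MeasurableSpace N] [BorelSpace N] (x : N)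

omit [IsManifold I 1 N] in
/-- The extended chart is a.e.-measurable for any measure restricted to its (open) domain.
[folklore] -/
theorem aemeasurable_extChartAt_restrict (μ : Measure N) :
    AEMeasurable (extChartAt I x) (μ.restrict (extChartAt I x).source) :=
  (continuousOn_extChartAt x).aemeasurable (isOpen_extChartAt_source x).measurableSet

omit [IsManifold I 1 N] in
/-- Preimages of measurable sets under the extended chart, cut down to the chart domain, are
measurable (the chart is continuous on its open domain). [folklore] -/
theorem measurableSet_source_inter_preimage_extChartAt {B : Set (EuclideanSpace ℝ (Fin m))}
    (hB : MeasurableSet B) : MeasurableSet ((extChartAt I x).source ∩ extChartAt I x ⁻¹' B) := by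
  classical
  have hs : MeasurableSet (extChartAt I x).source := (isOpen_extChartAt_source x).measurableSet
  have hm : Measurable ((extChartAt I x).source.piecewise (extChartAt I x)
      (fun _ ↦ extChartAt I x x)) :=
    (continuousOn_extChartAt x).measurable_piecewise continuousOn_const hs
  have : (extChartAt I x).source ∩ extChartAt I x ⁻¹' B = (extChartAt I x).source ∩
      ((extChartAt I x).source.piecewise (extChartAt I x) (fun _ ↦ extChartAt I x x)) ⁻¹' B := by
    ext p
    simp only [mem_inter_iff, mem_preimage]
    constructor
    · rintro ⟨hp, hpB⟩; exact ⟨hp, by rwa [piecewise_eq_of_mem _ _ _ hp]⟩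
    · rintro ⟨hp, hpB⟩; exact ⟨hp, by rwa [piecewise_eq_of_mem _ _ _ hp] at hpB⟩
  rw [this]
  exact hs.inter (hm hB)

omit [IsManifold I 1 N] in
/-- The inverse extended chart is a.e.-measurable for Lebesgue measure restricted to the chart
target (it is continuous there). [folklore] -/
theorem aemeasurable_extChartAt_symm_restrict :
    AEMeasurable (extChartAt I x).symm
      ((volume : Measure (EuclideanSpace ℝ (Fin m))).restrict (extChartAt I x).target) :=
  (continuousOn_extChartAt_symm x).aemeasurable (measurableSet_extChartAt_target x)

end Chart

/-! ### The Riemannian measure in a chart -/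

section Measure

variable [T3Space N] [MeasurableSpace N] [BorelSpace N]
  (h : ContMDiffRiemannianMetric I n (EuclideanSpace ℝ (Fin m)) (TangentSpace I : N → Type _))
  (x : N)

/-- **The Riemannian measure in a chart.** The push-forward under the extended chart
`φ = extChartAt I x` of the Riemannian measure `μ_h` restricted to the chart domain is Lebesgue
measure on the chart target with density `√(det h_{ij})`:
`φ_* (μ_h|_{φ.source}) = √(det h_{ij}) · vol|_{φ.target}`. This is the measure-theoretic content of
`dV = √(det h_{ij}) dy¹⋯dy^m` (Chavel 2006, §III.3, (III.3.5); Lee 2018, Prop. 2.41), obtained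
from the chart formula on sets (`riemannianMeasure_eq_integral_sqrt_det_holds`; Federer 1969,
§3.2.46). [cite: Federer1969, §3.2.46] -/
theorem map_extChartAt_restrict_riemannianMeasure :
    ((riemannianMeasure h).restrict (extChartAt I x).source).map (extChartAt I x) =
      ((volume : Measure (EuclideanSpace ℝ (Fin m))).restrict (extChartAt I x).target).withDensity
        (fun y ↦ ENNReal.ofReal (Real.sqrt (chartGramMatrix h x y).det)) := by
  refine Measure.ext (fun B hB ↦ ?_)
  have hs : MeasurableSet (extChartAt I x).source := (isOpen_extChartAt_source x).measurableSet
  rw [Measure.map_apply_of_aemeasurable (aemeasurable_extChartAt_restrict x _) hB,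
    Measure.restrict_apply' hs, withDensity_apply _ hB, Measure.restrict_restrict hB]
  have hS : MeasurableSet (extChartAt I x ⁻¹' B ∩ (extChartAt I x).source) := by
    rw [inter_comm]; exact measurableSet_source_inter_preimage_extChartAt x hB
  rw [riemannianMeasure_eq_integral_sqrt_det_holds h x hS inter_subset_right]
  congr 1
  -- `φ (φ⁻¹ B ∩ φ.source) = B ∩ φ.target`
  rw [inter_comm, (extChartAt I x).image_source_inter_eq', inter_comm]
  congr 1
  ext y
  simp only [mem_inter_iff, mem_preimage]
  constructor
  · rintro ⟨hyB, hyt⟩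
    exact ⟨by rwa [(extChartAt I x).right_inv hyt] at hyB, hyt⟩
  · rintro ⟨hyB, hyt⟩
    exact ⟨by rwa [(extChartAt I x).right_inv hyt], hyt⟩

/-- **Change of variables to a chart, Lebesgue integral.** For `g : ℝ^m → [0, ∞]` a.e.-measurable
on the chart target, `∫_{φ.source} g(φ p) dμ_h(p) = ∫_{φ.target} g(y) √(det h_{ij}(y)) dy`.
Chavel 2006, §III.3, (III.3.6). [cite: Chavel2006, §III.3 (III.3.6)] -/
theorem setLIntegral_extChartAt_comp {g : EuclideanSpace ℝ (Fin m) → ℝ≥0∞}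
    (hg : AEMeasurable g ((volume : Measure (EuclideanSpace ℝ (Fin m))).restrict
      (extChartAt I x).target)) :
    ∫⁻ p in (extChartAt I x).source, g (extChartAt I x p) ∂riemannianMeasure h =
      ∫⁻ y in (extChartAt I x).target, g y * ENNReal.ofReal (Real.sqrt (chartGramMatrix h x y).det) := by
  have hρ := aemeasurable_ofReal_sqrt_det_chartGramMatrix h x
  have hg' : AEMeasurable g (((riemannianMeasure h).restrict (extChartAt I x).source).map
      (extChartAt I x)) := by
    rw [map_extChartAt_restrict_riemannianMeasure h x]
    exact hg.mono_ac (withDensity_absolutelyContinuous _ _)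
  rw [← lintegral_map' hg' (aemeasurable_extChartAt_restrict x _),
    map_extChartAt_restrict_riemannianMeasure h x, lintegral_withDensity_eq_lintegral_mul₀ hρ hg]
  refine lintegral_congr (fun y ↦ ?_)
  simp only [Pi.mul_apply, mul_comm]

/-- **Chart formula for the integral of a nonnegative function.** If `u : N → [0, ∞]` is measurable
and vanishes off the domain of the extended chart `φ` at `x`, then
`∫_N u dμ_h = ∫_{φ.target} u(φ⁻¹ y) √(det h_{ij}(y)) dy`. Chavel 2006, §III.3, (III.3.6)
(`∫_M f dV = ∫ (f √g) ∘ x⁻¹` for `f` supported in a chart). [cite: Chavel2006, §III.3 (III.3.6)] -/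
theorem lintegral_eq_lintegral_chart {u : N → ℝ≥0∞} (hu : Measurable u)
    (hsupp : support u ⊆ (extChartAt I x).source) :
    ∫⁻ p, u p ∂riemannianMeasure h =
      ∫⁻ y in (extChartAt I x).target,
        u ((extChartAt I x).symm y) * ENNReal.ofReal (Real.sqrt (chartGramMatrix h x y).det) := by
  have hs : MeasurableSet (extChartAt I x).source := (isOpen_extChartAt_source x).measurableSet
  rw [← setLIntegral_eq_of_support_subset hsupp]
  have h1 : ∫⁻ p in (extChartAt I x).source, u p ∂riemannianMeasure h =
      ∫⁻ p in (extChartAt I x).source, (u ∘ (extChartAt I x).symm) (extChartAt I x p)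
        ∂riemannianMeasure h :=
    setLIntegral_congr_fun hs (fun p hp ↦ by
      simp only [Function.comp_apply, (extChartAt I x).left_inv hp])
  rw [h1, setLIntegral_extChartAt_comp h x
    (hu.comp_aemeasurable (aemeasurable_extChartAt_symm_restrict x))]
  rfl

/-- **Change of variables to a chart, Bochner integral.** For `g : ℝ^m → E` a.e.-strongly
measurable on the chart target, `∫_{φ.source} g(φ p) dμ_h(p) = ∫_{φ.target} √(det h_{ij}(y)) • g(y) dy`
(both sides being `0` when not integrable, see `integrableOn_extChartAt_comp_iff`). Chavel 2006,
§III.3, (III.3.6). [cite: Chavel2006, §III.3 (III.3.6)] -/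
theorem setIntegral_extChartAt_comp {E : Type*} [NormedAddCommGroup E] [NormedSpace ℝ E]
    {g : EuclideanSpace ℝ (Fin m) → E}
    (hg : AEStronglyMeasurable g ((volume : Measure (EuclideanSpace ℝ (Fin m))).restrict
      (extChartAt I x).target)) :
    ∫ p in (extChartAt I x).source, g (extChartAt I x p) ∂riemannianMeasure h =
      ∫ y in (extChartAt I x).target, Real.sqrt (chartGramMatrix h x y).det • g y := by
  have hρ := aemeasurable_ofReal_sqrt_det_chartGramMatrix h x
  have hg' : AEStronglyMeasurable g (((riemannianMeasure h).restrict (extChartAt I x).source).map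
      (extChartAt I x)) := by
    rw [map_extChartAt_restrict_riemannianMeasure h x]
    exact hg.mono_ac (withDensity_absolutelyContinuous _ _)
  rw [← integral_map (aemeasurable_extChartAt_restrict x _) hg',
    map_extChartAt_restrict_riemannianMeasure h x,
    integral_withDensity_eq_integral_toReal_smul₀ hρ (Eventually.of_forall fun _ ↦ ENNReal.ofReal_lt_top)]
  refine integral_congr_ae (Eventually.of_forall fun y ↦ ?_)
  simp only [ENNReal.toReal_ofReal (Real.sqrt_nonneg _)]

/-- **Integrability in a chart.** For `g` a.e.-strongly measurable on the chart target,
`p ↦ g(φ p)` is `μ_h`-integrable on `φ.source` iff `y ↦ √(det h_{ij}(y)) • g(y)` is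
Lebesgue-integrable on `φ.target`. [cite: Chavel2006, §III.3 (III.3.6)] -/
theorem integrableOn_extChartAt_comp_iff {E : Type*} [NormedAddCommGroup E] [NormedSpace ℝ E]
    {g : EuclideanSpace ℝ (Fin m) → E}
    (hg : AEStronglyMeasurable g ((volume : Measure (EuclideanSpace ℝ (Fin m))).restrict
      (extChartAt I x).target)) :
    IntegrableOn (fun p ↦ g (extChartAt I x p)) (extChartAt I x).source (riemannianMeasure h) ↔
      IntegrableOn (fun y ↦ Real.sqrt (chartGramMatrix h x y).det • g y) (extChartAt I x).target := by
  have hρ := aemeasurable_ofReal_sqrt_det_chartGramMatrix h x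
  have hg' : AEStronglyMeasurable g (((riemannianMeasure h).restrict (extChartAt I x).source).map
      (extChartAt I x)) := by
    rw [map_extChartAt_restrict_riemannianMeasure h x]
    exact hg.mono_ac (withDensity_absolutelyContinuous _ _)
  have h1 := integrable_map_measure hg' (aemeasurable_extChartAt_restrict x (riemannianMeasure h))
  rw [map_extChartAt_restrict_riemannianMeasure h x,
    integrable_withDensity_iff_integrable_smul₀' hρ
      (Eventually.of_forall fun _ ↦ ENNReal.ofReal_lt_top)] at h1
  rw [IntegrableOn, IntegrableOn, ← show (g ∘ extChartAt I x) = fun p ↦ g (extChartAt I x p) from rfl,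
    ← h1]
  refine integrable_congr (Eventually.of_forall fun y ↦ ?_)
  simp only [ENNReal.toReal_ofReal (Real.sqrt_nonneg _)]

/-- **Chart formula for the integral of a real (or vector-valued) function.** If `u : N → E` is
measurable (`E` second countable, e.g. `ℝ`) and vanishes off the domain of the extended chart `φ`
at `x`, then `∫_N u dμ_h = ∫_{φ.target} √(det h_{ij}(y)) • u(φ⁻¹ y) dy`. Chavel 2006, §III.3,
(III.3.6); Lee 2018, Prop. 2.41 ff. [cite: Chavel2006, §III.3 (III.3.6)] -/
theorem integral_eq_integral_chart {E : Type*} [NormedAddCommGroup E] [NormedSpace ℝ E]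
    [MeasurableSpace E] [BorelSpace E] [SecondCountableTopology E]
    {u : N → E} (hu : Measurable u) (hsupp : support u ⊆ (extChartAt I x).source) :
    ∫ p, u p ∂riemannianMeasure h =
      ∫ y in (extChartAt I x).target,
        Real.sqrt (chartGramMatrix h x y).det • u ((extChartAt I x).symm y) := by
  have hs : MeasurableSet (extChartAt I x).source := (isOpen_extChartAt_source x).measurableSet
  rw [← setIntegral_eq_integral_of_forall_compl_eq_zero (s := (extChartAt I x).source)
    (fun p hp ↦ notMem_support.1 (fun hp' ↦ hp (hsupp hp')))]
  have h1 : ∫ p in (extChartAt I x).source, u p ∂riemannianMeasure h =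
      ∫ p in (extChartAt I x).source, (u ∘ (extChartAt I x).symm) (extChartAt I x p)
        ∂riemannianMeasure h :=
    setIntegral_congr_fun hs (fun p hp ↦ by
      simp only [Function.comp_apply, (extChartAt I x).left_inv hp])
  rw [h1, setIntegral_extChartAt_comp h x
    (hu.comp_aemeasurable (aemeasurable_extChartAt_symm_restrict x)).aestronglyMeasurable]
  rfl

/-- **Integrability criterion in a chart.** A measurable `u : N → E` vanishing off the domain of the
extended chart `φ` at `x` is `μ_h`-integrable iff `y ↦ √(det h_{ij}(y)) • u(φ⁻¹ y)` is
Lebesgue-integrable on `φ.target`. [cite: Chavel2006, §III.3 (III.3.6)] -/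
theorem integrable_iff_integrableOn_chart {E : Type*} [NormedAddCommGroup E] [NormedSpace ℝ E]
    [MeasurableSpace E] [BorelSpace E] [SecondCountableTopology E]
    {u : N → E} (hu : Measurable u) (hsupp : support u ⊆ (extChartAt I x).source) :
    Integrable u (riemannianMeasure h) ↔
      IntegrableOn (fun y ↦ Real.sqrt (chartGramMatrix h x y).det • u ((extChartAt I x).symm y))
        (extChartAt I x).target := by
  have hs : MeasurableSet (extChartAt I x).source := (isOpen_extChartAt_source x).measurableSet
  have h0 : Integrable u (riemannianMeasure h) ↔
      IntegrableOn u (extChartAt I x).source (riemannianMeasure h) := by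
    rw [← integrable_indicator_iff hs, indicator_eq_self.2 hsupp]
  have h1 : IntegrableOn u (extChartAt I x).source (riemannianMeasure h) ↔
      IntegrableOn (fun p ↦ (u ∘ (extChartAt I x).symm) (extChartAt I x p))
        (extChartAt I x).source (riemannianMeasure h) :=
    integrableOn_congr_fun (fun p hp ↦ by
      simp only [Function.comp_apply, (extChartAt I x).left_inv hp]) hs
  rw [h0, h1, integrableOn_extChartAt_comp_iff h x
    (hu.comp_aemeasurable (aemeasurable_extChartAt_symm_restrict x)).aestronglyMeasurable]
  rfl

end Measure

end Literature.Geometry.Lorentzian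

end
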